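import Summits.KontsevichZagierPeriods.KontsevichZagierPeriods.Theses.HeckeMultiplicityOne
import Summits.KontsevichZagierPeriods.KontsevichZagierPeriods.Theorems.MzvKernelInKZ.Negative.ScalingDivision

/-!
# `TorsionFree` (stmt-KontsevichZagierPeriods-4691, route `HeckeMultiplicityOne`, support item #9)

`P_KZ = KZ.FormalRep ⧸ KZ.relations` is torsion-free: for every formal representation `c` and every
integer `a ≠ 0`, `a • c ∈ KZ.relations → c ∈ KZ.relations` ("division by an integer is admissible
although it is not a rule"). This is the integer version of the derived rule already in the tree for
natural multipliers, `Summit.KontsevichZagierPeriods.MzvKernelInKZ.Negative.mem_relations_of_nsmul_mem`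
(`Theorems/MzvKernelInKZ/Negative/ScalingDivision.lean`): the scaling endomorphism `KZ.scale a`
(`[σ, f] ↦ [σ, a·f]`, `a` real algebraic; `KZRelationsLE.lean`) preserves `KZ.relations`, and modulo
relations `scale 1 ≡ id`, `scale (a·b) ≡ scale a ∘ scale b`, `scale n ≡ n • ·` (integrand additivity),
so `c ≡ scale n⁻¹ (scale n c) ≡ scale n⁻¹ (n • c) ∈ relations`. The passage from `a : ℤ` to
`n = |a| : ℕ` is `Int.natAbs_eq` (`a = n` or `a = -n`) and `-x ∈ relations ↔ x ∈ relations`.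

Load-bearing for the route's Assembly (Commensurability → TorsionFree → Statement): it is where the
denominators of the Hecke projector (691 for Δ, 5 for X₀(11)) are paid for.

Sources: M. Kontsevich, D. Zagier, *Periods* (2001), §1.2 (rules (1b), (2));
A. Huber, S. Müller-Stach, *Periods and Nori Motives* (2017), §13.1.
-/

namespace Summit.KontsevichZagierPeriods.HeckeMultiplicityOne

open Literature.NumberTheory.Transcendental

/-- **Integer division is a derived rule of the KZ calculus** (ℤ-version): for `c : KZ.FormalRep` and
an integer `a ≠ 0`, `a • c ∈ KZ.relations → c ∈ KZ.relations`. Reduced to the natural-number version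
`MzvKernelInKZ.Negative.mem_relations_of_nsmul_mem` with `n = a.natAbs`, using `a = ±n`
(`Int.natAbs_eq`) and closure of `KZ.relations` under negation. [folklore] -/
theorem mem_relations_of_zsmul_mem {c : KZ.FormalRep} {a : ℤ} (ha : a ≠ 0)
    (h : a • c ∈ KZ.relations) : c ∈ KZ.relations := by
  have hn : 0 < a.natAbs := Int.natAbs_pos.mpr ha
  refine Summit.KontsevichZagierPeriods.MzvKernelInKZ.Negative.mem_relations_of_nsmul_mem hn ?_
  rw [← natCast_zsmul]
  rcases Int.natAbs_eq a with h' | h'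
  · rw [← h']
    exact h
  · have e : (a.natAbs : ℤ) = -a := by omega
    rw [e, neg_smul]
    exact neg_mem h

/-- **Route item `HeckeMultiplicityOne.TorsionFree`** (stmt-KontsevichZagierPeriods-4691):
`P_KZ = FormalRep ⧸ relations` is torsion-free — `a ≠ 0` and `a • c ∈ KZ.relations` imply
`c ∈ KZ.relations`. Immediate from `mem_relations_of_zsmul_mem`. [folklore] -/
theorem torsionFree_proof :
    Summit.KontsevichZagierPeriods.KontsevichZagierPeriods.Theses.HeckeMultiplicityOne.TorsionFree := by
  unfold Summit.KontsevichZagierPeriods.KontsevichZagierPeriods.Theses.HeckeMultiplicityOne.TorsionFree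
  intro c a ha h
  exact mem_relations_of_zsmul_mem ha h

end Summit.KontsevichZagierPeriods.HeckeMultiplicityOne
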